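import Summits.KontsevichZagierPeriods.KontsevichZagierPeriods.Theorems.SoloInformedAlgTheorem2DAll
import Summits.KontsevichZagierPeriods.KontsevichZagierPeriods.Theorems.SoloInformedKZCubeGrid
import HarnessLib

/-!
# The domain calculus: presentability of a function on a semialgebraic set

Solo programme `solo-KontsevichZagierPeriods-informed`, session s110, PRES-RAT(2) step (β)-1.

THEOREM 2D⁺ (`soloInformed_presentableDenK_dim2_all`) makes every `K`-rational integrand on the
full open square presentable.  For a rational `IntegralRep` on a GENERAL semialgebraic domain the
induction has to carry the domain, and this file sets up the corresponding bookkeeping predicate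

* `SoloInformedPresOn Ω f` — every `IntegralRep` with domain `Ω` and integrand `f` on `Ω` is
  presentable —

together with its rules: null sets and null enlargements (rule (1)), finite covers with null
overlaps (rule (1) iterated, `soloInformed_of_sub_sum_mem_relations_of_iUnion`), transport along a
semialgebraic injective `C¹` change of variables (rule (2),
`soloInformed_presOn_image`), the LOCAL-GLOBAL principle on the closed cube
(`soloInformed_presOn_of_locally`: local presentability near every point of `[0,1]ⁿ`, via a
Lebesgue number and the grid cells of `SoloInformedKZCubeGrid`), and the three elementary local
leaves: exterior points, interior points (full cells, THEOREM 2D⁺ transported to a grid cell,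
`soloInformed_presOn_gridCell_rational`) and null pieces.

References: M. Kontsevich, D. Zagier, *Periods* (2001) §1.2 rules (1)–(2).
-/

noncomputable section

open scoped BigOperators Topology
open MeasureTheory Set
open Literature.NumberTheory.Transcendental Literature.NumberTheory.Transcendental.KZ
open Literature.ModelTheory.ExponentialFields (IsSemialgebraic)

namespace Summit.KontsevichZagierPeriods.KontsevichZagierPeriods.Theorems

variable {n : ℕ} {K : Type*} [Field K] [Algebra K ℝ]

/-! ### The predicate -/

/-- **Presentability of `f` on `Ω`**: every integral representation with domain `Ω` whose
integrand agrees with `f` on `Ω` is presentable. [this work] -/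
def SoloInformedPresOn (Ω : Set (Fin n → ℝ)) (f : (Fin n → ℝ) → ℝ) : Prop :=
  ∀ r : IntegralRep n, r.domain = Ω → EqOn r.integrand f Ω → of r ∈ soloInformedPresentable

/-- `SoloInformedPresOn Ω` only depends on `f` on `Ω`. [this work] -/
theorem soloInformed_presOn_congr {Ω : Set (Fin n → ℝ)} {f g : (Fin n → ℝ) → ℝ}
    (h : EqOn f g Ω) : SoloInformedPresOn Ω f ↔ SoloInformedPresOn Ω g :=
  ⟨fun H r hr hri => H r hr fun _ hx => (hri hx).trans (h hx).symm,
    fun H r hr hri => H r hr fun _ hx => (hri hx).trans (h hx)⟩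

/-- **Rule (1), null domains.** [Kontsevich–Zagier 2001 §1.2 rule (1)] -/
theorem soloInformed_presOn_of_null {Ω : Set (Fin n → ℝ)} {f : (Fin n → ℝ) → ℝ}
    (hΩ : volume Ω = 0) : SoloInformedPresOn Ω f :=
  fun r hr _ => soloInformed_presentable_of_mem_relations
    (of_mem_relations_of_volume_eq_zero r (by rw [hr]; exact hΩ))

/-- The empty domain. [this work] -/
theorem soloInformed_presOn_empty (f : (Fin n → ℝ) → ℝ) :
    SoloInformedPresOn (∅ : Set (Fin n → ℝ)) f :=
  soloInformed_presOn_of_null (by simp)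

/-- **Rule (1), null enlargement.**  If `Ω' ⊆ Ω` is `ℚ`-semialgebraic with `Ω ∖ Ω'` null, then
presentability on `Ω'` gives presentability on `Ω`. [Kontsevich–Zagier 2001 §1.2 rule (1)] -/
theorem soloInformed_presOn_of_subset_null {Ω Ω' : Set (Fin n → ℝ)} {f : (Fin n → ℝ) → ℝ}
    (hΩ' : IsSemialgebraic ℚ Ω') (hsub : Ω' ⊆ Ω) (hvol : volume (Ω \ Ω') = 0)
    (h : SoloInformedPresOn Ω' f) : SoloInformedPresOn Ω f := by
  intro r hr hri
  have hsub' : Ω' ⊆ r.domain := by rw [hr]; exact hsub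
  have hrel := r.of_sub_of_restrict_mem_relations hΩ' hsub' (by rw [hr]; exact hvol)
  exact soloInformed_presentable_of_sub_mem hrel
    (h _ (IntegralRep.domain_restrict _ _ _ _) fun x hx => hri (hsub hx))

/-- **Rule (1), finite covers.**  If `Ω = ⋃ᵢ Dᵢ` for finitely many `ℚ`-semialgebraic `Dᵢ` with
pairwise null overlaps and `f` is presentable on every `Dᵢ`, then `f` is presentable on `Ω`.
[Kontsevich–Zagier 2001 §1.2 rule (1)] -/
theorem soloInformed_presOn_of_iUnion {ι : Type*} [Fintype ι] {Ω : Set (Fin n → ℝ)}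
    {f : (Fin n → ℝ) → ℝ} (D : ι → Set (Fin n → ℝ)) (hD : ∀ i, IsSemialgebraic ℚ (D i))
    (hnull : ∀ i j, i ≠ j → volume (D i ∩ D j) = 0) (hΩ : Ω = ⋃ i, D i)
    (h : ∀ i, SoloInformedPresOn (D i) f) : SoloInformedPresOn Ω f := by
  classical
  intro r hr hri
  have hsub : ∀ i, D i ⊆ Ω := fun i => hΩ ▸ subset_iUnion D i
  have hsubr : ∀ i, D i ⊆ r.domain := fun i => by rw [hr]; exact hsub i
  have key := soloInformed_of_sub_sum_mem_relations_of_iUnion D hD hnull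
    (fun i => r.restrict (D i) (hD i) (hsubr i)) (fun _ => rfl) r (by rw [hr, hΩ])
    (fun _ _ _ => rfl)
  refine soloInformed_presentable_of_sub_mem key
    (soloInformed_presentable_sum _ _ fun i _ => ?_)
  exact h i _ rfl fun x hx => hri (hsub i hx)

/-! ### Rule (2): transport along a change of variables -/

/-- **Rule (2) for `SoloInformedPresOn`.**  Let `Φ` be a `ℚ`-semialgebraic injective map on the
`ℚ`-semialgebraic set `S`, differentiable within `S` with derivative `Φ'` whose Jacobian
`|det Φ'|` is a `ℚ`-semialgebraic function on `S`.  If `(f ∘ Φ) · |det Φ'|` is presentable on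
`S`, then `f` is presentable on `Φ(S)`. [Kontsevich–Zagier 2001 §1.2 rule (2)] -/
theorem soloInformed_presOn_image {S : Set (Fin n → ℝ)} (hS : IsSemialgebraic ℚ S)
    (Φ : (Fin n → ℝ) → (Fin n → ℝ)) (Φ' : (Fin n → ℝ) → (Fin n → ℝ) →L[ℝ] (Fin n → ℝ))
    (hΦs : IsSemialgebraicMapOn ℚ S Φ) (hΦd : ∀ x ∈ S, HasFDerivWithinAt Φ (Φ' x) S x)
    (hΦi : InjOn Φ S) (hJ : IsSemialgebraicFunOn ℚ S fun x => |(Φ' x).det|)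
    {f : (Fin n → ℝ) → ℝ} (h : SoloInformedPresOn S fun x => f (Φ x) * |(Φ' x).det|) :
    SoloInformedPresOn (Φ '' S) f := by
  intro r hdom hrf
  have hmeas : MeasurableSet S := IsSemialgebraic.measurableSet_holds hS
  have hmaps : MapsTo Φ S r.domain := fun x hx => by rw [hdom]; exact mem_image_of_mem Φ hx
  have hsa : IsSemialgebraicFunOn ℚ S fun x => r.integrand (Φ x) * |(Φ' x).det| :=
    (IsSemialgebraicFunOn.comp_isSemialgebraicMapOn_holds r.isSemialgebraicFunOn_integrand hΦs
      hmaps).fun_mul hJ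
  have hint : IntegrableOn (fun x => r.integrand (Φ x) * |(Φ' x).det|) S := by
    have h := r.integrableOn
    rw [hdom, integrableOn_image_iff_integrableOn_abs_det_fderiv_smul volume hmeas hΦd hΦi] at h
    exact h.congr_fun (fun x _ => by simp only [smul_eq_mul, mul_comm]) hmeas
  set ρ : IntegralRep n := ⟨S, fun x => r.integrand (Φ x) * |(Φ' x).det|, hS, hsa, hint⟩ with hρ
  have hrel : of ρ - of r ∈ relations :=
    changeOfVariablesRel_subset_relations ⟨n, ρ, r, Φ, Φ', hΦs, hΦd, hΦi, hdom, fun _ _ => rfl, rfl⟩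
  have hρp : of ρ ∈ soloInformedPresentable :=
    h ρ rfl fun x hx => by
      show r.integrand (Φ x) * |(Φ' x).det| = f (Φ x) * |(Φ' x).det|
      rw [hrf (hdom ▸ mem_image_of_mem Φ hx)]
  rw [← neg_sub] at hrel
  exact soloInformed_presentable_of_sub_mem (by simpa using relations.neg_mem hrel) hρp

/-! ### The LOCAL-GLOBAL principle on the closed cube -/

/-- **Local presentability** of `f` on `Ω` at `p`: for some `ε > 0`, `f` is presentable on
`Ω ∩ Z` for every grid cell `Z = ∏ₗ [jₗ/N, (jₗ+1)/N]` contained in the ball `B(p, ε)`.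
[this work] -/
def SoloInformedLocPresOn (Ω : Set (Fin n → ℝ)) (f : (Fin n → ℝ) → ℝ) (p : Fin n → ℝ) : Prop :=
  ∃ ε > (0 : ℝ), ∀ (N : ℕ) (j : Fin n → Fin N), 0 < N →
    soloInformedGridCell N j ⊆ Metric.ball p ε →
    SoloInformedPresOn (Ω ∩ soloInformedGridCell N j) f

/-- Shrinking the ball preserves local presentability. [this work] -/
theorem soloInformed_locPresOn_of_le {Ω : Set (Fin n → ℝ)} {f : (Fin n → ℝ) → ℝ}
    {p : Fin n → ℝ} {ε ε' : ℝ} (hε' : 0 < ε') (hle : ε' ≤ ε)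
    (h : ∀ (N : ℕ) (j : Fin n → Fin N), 0 < N → soloInformedGridCell N j ⊆ Metric.ball p ε →
      SoloInformedPresOn (Ω ∩ soloInformedGridCell N j) f) :
    SoloInformedLocPresOn Ω f p :=
  ⟨ε', hε', fun N j hN hZ => h N j hN (hZ.trans (Metric.ball_subset_ball hle))⟩

/-- A grid cell of mesh `1/N < δ` lies in the `δ`-ball about its corner. [this work] -/
theorem soloInformed_gridCell_subset_ball {N : ℕ} (hN : 0 < N) {δ : ℝ} (hδ : (1 : ℝ) / N < δ)
    (j : Fin n → Fin N) :
    soloInformedGridCell N j ⊆ Metric.ball (fun l => ((j l : ℕ) : ℝ) / N) δ := by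
  intro y hy
  have hNr : (0 : ℝ) < N := by exact_mod_cast hN
  have hδ0 : 0 < δ := lt_of_le_of_lt (by positivity) hδ
  rw [Metric.mem_ball, dist_pi_lt_iff hδ0]
  intro l
  obtain ⟨h1, h2⟩ := hy l
  rw [Real.dist_eq, abs_lt]
  have h3 : y l - ((j l : ℕ) : ℝ) / N ≤ 1 / N := by
    rw [add_div] at h2; linarith
  constructor <;> linarith

/-- **RULE LOCAL-GLOBAL for domains.**  A `ℚ`-semialgebraic `Ω ⊆ [0,1]ⁿ` on which `f` is
locally presentable at every point of the closed cube carries `f` presentably: a Lebesgue number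
of the cover by the balls of local presentability, a grid of smaller mesh, and rule (1) over the
cells. [this work] -/
theorem soloInformed_presOn_of_locally {Ω : Set (Fin n → ℝ)} {f : (Fin n → ℝ) → ℝ}
    (hΩ : IsSemialgebraic ℚ Ω) (hΩc : Ω ⊆ soloInformedCube n)
    (hloc : ∀ p ∈ soloInformedCube n, SoloInformedLocPresOn Ω f p) :
    SoloInformedPresOn Ω f := by
  classical
  choose! ε hε hH using hloc
  -- a Lebesgue number of the cover of the compact cube by the balls `B(p, ε_p)`
  obtain ⟨δ, hδ, hcover⟩ := lebesgue_number_lemma_of_metric (ι := soloInformedCube n)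
    (c := fun p => Metric.ball (p : Fin n → ℝ) (ε p)) (isCompact_soloInformedCube n)
    (fun _ => Metric.isOpen_ball)
    (fun x hx => Set.mem_iUnion.2 ⟨⟨x, hx⟩, Metric.mem_ball_self (hε x hx)⟩)
  -- a mesh `1/N < δ`
  obtain ⟨N₀, hN₀⟩ := exists_nat_one_div_lt hδ
  have hN : 0 < N₀ + 1 := Nat.succ_pos N₀
  have hmesh : (1 : ℝ) / ((N₀ + 1 : ℕ) : ℝ) < δ := by push_cast; exact hN₀
  -- rule (1) over the cells `Ω ∩ Z_j`
  refine soloInformed_presOn_of_iUnion (ι := Fin n → Fin (N₀ + 1))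
    (fun j => Ω ∩ soloInformedGridCell (N₀ + 1) j)
    (fun j => hΩ.inter (isSemialgebraic_soloInformedGridCell _ j))
    (fun j j' hjj' => measure_mono_null
      (show Ω ∩ soloInformedGridCell (N₀ + 1) j ∩ (Ω ∩ soloInformedGridCell (N₀ + 1) j') ⊆
          soloInformedGridCell (N₀ + 1) j ∩ soloInformedGridCell (N₀ + 1) j' from
        fun x hx => ⟨hx.1.2, hx.2.2⟩)
      (soloInformed_volume_gridCell_inter hjj'))
    (by rw [← inter_iUnion, soloInformed_iUnion_gridCell hN, inter_eq_left.2 hΩc]) fun j => ?_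
  -- the cell `j` lies in `B(j/N, δ) ⊆ B(p, ε_p)` for some `p`
  obtain ⟨⟨p, hp⟩, hball⟩ := hcover (fun l => ((j l : ℕ) : ℝ) / ((N₀ + 1 : ℕ) : ℝ))
    (soloInformed_gridCorner_mem_cube (c := fun l => (j l : ℕ)) fun l => (j l).isLt)
  exact hH p hp (N₀ + 1) j hN ((soloInformed_gridCell_subset_ball hN hmesh j).trans hball)

/-! ### Elementary local leaves -/

/-- **Leaf L-out.**  `f` is locally presentable on `Ω` at every point with a neighbourhood
disjoint from `Ω` (the cells there meet `Ω` in the empty set). [this work] -/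
theorem soloInformed_locPresOn_of_disjoint {Ω : Set (Fin n → ℝ)} {f : (Fin n → ℝ) → ℝ}
    {p : Fin n → ℝ} {ε : ℝ} (hε : 0 < ε) (hdisj : Disjoint (Metric.ball p ε) Ω) :
    SoloInformedLocPresOn Ω f p := by
  refine ⟨ε, hε, fun N j _ hZ => ?_⟩
  have h0 : Ω ∩ soloInformedGridCell N j = ∅ :=
    Set.eq_empty_iff_forall_notMem.2 fun x hx => hdisj.le_bot ⟨hZ hx.2, hx.1⟩
  rw [h0]
  exact soloInformed_presOn_empty f

/-- **Full cells.**  Over a field `K` of real algebraic numbers all of whose polynomials are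
presentable denominators (`n = 2`: THEOREM 2D⁺), every `K`-rational function is presentable on
every closed grid cell: rule (2) along the grid map `x ↦ (j + x)/N`, whose pulled-back form is
`N⁻ⁿ P((j+x)/N) / Q((j+x)/N)`. [this work] -/
theorem soloInformed_presOn_gridCell_rational
    (hall : ∀ Q : MvPolynomial (Fin n) K, SoloInformedPresentableDenK Q)
    {N : ℕ} (hN : 0 < N) (j : Fin n → Fin N) (P Q : MvPolynomial (Fin n) K) :
    SoloInformedPresOn (soloInformedGridCell N j)
      (fun x => (MvPolynomial.aeval x P : ℝ) / MvPolynomial.aeval x Q) := by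
  have hNr : (0 : ℝ) < N := by exact_mod_cast hN
  rw [← soloInformed_image_gridMap_cube hN j]
  refine soloInformed_presOn_image (isSemialgebraic_soloInformedCube n) (soloInformedGridMap N j)
    (fun _ => (N : ℝ)⁻¹ • ContinuousLinearMap.id ℝ (Fin n → ℝ))
    (soloInformed_isSemialgebraicMapOn_gridMap N j)
    (fun x _ => soloInformed_hasFDerivWithinAt_gridMap N j _ x)
    ((soloInformed_gridMap_injective hN j).injOn) ?_ ?_
  · -- the Jacobian is the rational constant `N⁻ⁿ`
    refine (isSemialgebraicFunOn_const_ratCast (isSemialgebraic_soloInformedCube n)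
      (((N : ℚ)⁻¹) ^ n)).congr fun x _ => ?_
    rw [soloInformed_det_gridMap_deriv, abs_of_nonneg (by positivity)]
    push_cast
    rfl
  · -- the pulled-back form is `K`-rational on the cube: a presentable denominator
    intro ρ hρ hρi
    set c : Fin n → ℕ := fun l => (j l : ℕ) with hc
    have hmove : ∀ x : Fin n → ℝ,
        soloInformedGridMoveR Finset.univ N c x = soloInformedGridMap N j x := fun x => by
      rw [soloInformed_gridMoveR_univ]; rfl
    refine hall (soloInformedGridSubstK Finset.univ N c Q)
      (MvPolynomial.C (((N : K)⁻¹) ^ n) * soloInformedGridSubstK Finset.univ N c P) ρ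
      (by rw [hρ]; exact soloInformedOpenCube_subset_cube n) (le_of_eq hρ) fun x hx => ?_
    rw [hρi (soloInformedOpenCube_subset_cube n hx)]
    simp only [map_mul, MvPolynomial.aeval_C, soloInformed_aeval_gridSubstK, hmove,
      soloInformed_det_gridMap_deriv, map_pow, map_inv₀, map_natCast,
      abs_of_nonneg (pow_nonneg (inv_nonneg.2 hNr.le) n)]
    ring

/-- **Full cells in two variables.**  Over a field of real algebraic numbers closed under real
algebraic roots, every `K`-rational function of two variables is presentable on every closed grid
cell (THEOREM 2D⁺). [this work] -/
theorem soloInformed_presOn_gridCell_rational_dim2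
    (hK : ∀ c : K, IsAlgebraic ℚ (algebraMap K ℝ c)) (hKrc : SoloInformedRealRootClosed K)
    {N : ℕ} (hN : 0 < N) (j : Fin 2 → Fin N) (P Q : MvPolynomial (Fin 2) K) :
    SoloInformedPresOn (soloInformedGridCell N j)
      (fun x => (MvPolynomial.aeval x P : ℝ) / MvPolynomial.aeval x Q) :=
  soloInformed_presOn_gridCell_rational (soloInformed_presentableDenK_dim2_all hK hKrc) hN j P Q

/-- **Leaf L-in.**  A `K`-rational function of two variables (`K` as in THEOREM 2D⁺) is locally
presentable on `Ω` at every point `p` with `B(p, ε) ∩ [0,1]² ⊆ Ω`: the cells there are full.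
[this work] -/
theorem soloInformed_locPresOn_of_ball_subset
    (hK : ∀ c : K, IsAlgebraic ℚ (algebraMap K ℝ c)) (hKrc : SoloInformedRealRootClosed K)
    {Ω : Set (Fin 2 → ℝ)} (P Q : MvPolynomial (Fin 2) K) {p : Fin 2 → ℝ} {ε : ℝ} (hε : 0 < ε)
    (hΩ : Metric.ball p ε ∩ soloInformedCube 2 ⊆ Ω) :
    SoloInformedLocPresOn Ω (fun x => (MvPolynomial.aeval x P : ℝ) / MvPolynomial.aeval x Q) p := by
  refine ⟨ε, hε, fun N j hN hZ => ?_⟩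
  have hZΩ : soloInformedGridCell N j ⊆ Ω := fun x hx =>
    hΩ ⟨hZ hx, soloInformedGridCell_subset_cube j hx⟩
  rw [inter_eq_right.2 hZΩ]
  exact soloInformed_presOn_gridCell_rational_dim2 hK hKrc hN j P Q

end Summit.KontsevichZagierPeriods.KontsevichZagierPeriods.Theorems
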